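import Mathlib
import Summits.Ventures.PercRepro2.MixChordOStarSupport
import Summits.Ventures.PercRepro2.MixChordOStarBMain

/-!
# The `o`–root star along the other `o`-edge in the SUPPORT GRAPH (blind cell PercRepro2, night-1 g24;
proofs/NIGHT1-G24.md §8a′)

`dChord_other_o_edge_of_o_root_star` (MixChordOStarBMain.lean) asks for `g = {a₃, o}` and `e = {a₃, a₁}` to be
the only edges at `a₃`; here every other edge at `a₃` may be present with weight `0` — the support transport
of MixChordOStarSupport.lean (`starSupport`, `nMixChord_normD_restrict_iff`) with the chord edge `f' = {o, a₂}`
and the other `o`-edge `f = {o, a₁}` both in the support.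

* **`dChord_other_o_edge_of_o_root_star_support`** / **`dz2Chord_other_o_edge_of_o_root_star_support`**;
* the mirrors **`dChord_other_o_edge₂_of_o_root_star_support`** / **`dz2Chord_other_o_edge₂_of_o_root_star_support`**
  (edges `{a₃, o}`, `{a₃, a₂}` at `a₃` up to zero-weight edges, the chord along `{o, a₁}`).

Own code; standard axioms.
-/

namespace Summit.Ventures.PercRepro2

open UnionCluster CovForm

namespace Mix

namespace OStar

open Support

section BSupport

variable {V : Type*} {E : Type*} [Fintype E] [DecidableEq E] [Fintype V] [DecidableEq V] {R : Type*}
  [Field R] [LinearOrder R] [IsStrictOrderedRing R]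

variable (p : E → R) (ends : E → Sym2 V) {o a₁ a₂ a₃ : V} (b : V) {g e f f' : E}

/-- **The `o`–root star along the other `o`-edge, in the support graph**: `a₃` with the edges `g = {a₃, o}`,
`e = {a₃, a₁}` and otherwise only zero-weight edges; the `D`-chord along `f' = {o, a₂}`, the `o`-edge
`f = {o, a₁}` present with any weight. -/
theorem dChord_other_o_edge_of_o_root_star_support (hp : IsProbVec p) (hf : ends f = s(o, a₁))
    (hf' : ends f' = s(o, a₂)) (hg : ends g = s(a₃, o)) (he : ends e = s(a₃, a₁))
    (hstar : ∀ e', a₃ ∈ ends e' → e' ≠ g → e' ≠ e → p e' = 0)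
    (h12 : a₁ ≠ a₂) (h13 : a₁ ≠ a₃) (h23 : a₂ ≠ a₃) (ho1 : o ≠ a₁) (ho2 : o ≠ a₂) (ho3 : o ≠ a₃)
    (hb3 : b ≠ a₃) :
    NMixChord (normD ends a₁ a₂ a₃) p ends o a₁ a₂ a₃ b f' := by
  have hS := starSupport_zero p ends hstar
  have hfS := o_edge_mem_starSupport ends (g := g) (e := e) hf ho3 h13.symm
  have hf'S := o_edge_mem_starSupport ends (g := g) (e := e) hf' ho3 h23.symm
  rw [nMixChord_normD_restrict_iff _ hS ends o a₁ a₂ a₃ b hf'S]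
  have hg' : restrictEnds (starSupport ends a₃ g e) ends ⟨g, g_mem_starSupport ends⟩ = s(a₃, o) := hg
  have he' : restrictEnds (starSupport ends a₃ g e) ends ⟨e, e_mem_starSupport ends⟩ = s(a₃, a₁) := he
  have hf'' : restrictEnds (starSupport ends a₃ g e) ends ⟨f, hfS⟩ = s(o, a₁) := hf
  exact dChord_other_o_edge_of_o_root_star _ _ b (isProbVec_restrict p _ hp) hf'' hf' hg' he'
    (star_restrict ends) h12 h13 h23 ho1 ho2 ho3 hb3

/-- **The chain's row along the other `o`-edge in the support graph** (`NMixChord normDZ2`). -/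
theorem dz2Chord_other_o_edge_of_o_root_star_support (hp : IsProbVec p) (hf : ends f = s(o, a₁))
    (hf' : ends f' = s(o, a₂)) (hg : ends g = s(a₃, o)) (he : ends e = s(a₃, a₁))
    (hstar : ∀ e', a₃ ∈ ends e' → e' ≠ g → e' ≠ e → p e' = 0)
    (h12 : a₁ ≠ a₂) (h13 : a₁ ≠ a₃) (h23 : a₂ ≠ a₃) (ho1 : o ≠ a₁) (ho2 : o ≠ a₂) (ho3 : o ≠ a₃)
    (hb3 : b ≠ a₃) :
    NMixChord (normDZ2 ends a₁ a₂ a₃) p ends o a₁ a₂ a₃ b f' :=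
  nMixChord_DZ2_of_D hp
    (dChord_other_o_edge_of_o_root_star_support p ends b hp hf hf' hg he hstar h12 h13 h23 ho1 ho2 ho3 hb3)
    (HCov_o_root_star_support (Function.update p f' 0) ends b (hp.update f' le_rfl zero_le_one) hg he
      (fun e' h3 hg' he' => by
        rw [Function.update_of_ne]
        · exact hstar e' h3 hg' he'
        · intro hef
          rw [hef, hf', Sym2.mem_iff] at h3
          rcases h3 with h | h
          · exact ho3 h.symm
          · exact h23 h.symm)
      h13 h23 ho1 ho3 hb3)

/-- The mirror in the support graph: edges `{a₃, o}`, `{a₃, a₂}` (up to zero-weight edges), the chord along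
`{o, a₁}`. -/
theorem dChord_other_o_edge₂_of_o_root_star_support (hp : IsProbVec p) (hf : ends f = s(o, a₂))
    (hf' : ends f' = s(o, a₁)) (hg : ends g = s(a₃, o)) (he : ends e = s(a₃, a₂))
    (hstar : ∀ e', a₃ ∈ ends e' → e' ≠ g → e' ≠ e → p e' = 0)
    (h12 : a₁ ≠ a₂) (h13 : a₁ ≠ a₃) (h23 : a₂ ≠ a₃) (ho1 : o ≠ a₁) (ho2 : o ≠ a₂) (ho3 : o ≠ a₃)
    (hb3 : b ≠ a₃) :
    NMixChord (normD ends a₁ a₂ a₃) p ends o a₁ a₂ a₃ b f' :=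
  (nMixChord_normD_root_swap p ends b o a₁ a₂ a₃ f').1
    (dChord_other_o_edge_of_o_root_star_support p ends b hp hf hf' hg he hstar h12.symm h23 h13 ho2 ho1 ho3
      hb3)

/-- The mirror of the `DZ2` row in the support graph. -/
theorem dz2Chord_other_o_edge₂_of_o_root_star_support (hp : IsProbVec p) (hf : ends f = s(o, a₂))
    (hf' : ends f' = s(o, a₁)) (hg : ends g = s(a₃, o)) (he : ends e = s(a₃, a₂))
    (hstar : ∀ e', a₃ ∈ ends e' → e' ≠ g → e' ≠ e → p e' = 0)
    (h12 : a₁ ≠ a₂) (h13 : a₁ ≠ a₃) (h23 : a₂ ≠ a₃) (ho1 : o ≠ a₁) (ho2 : o ≠ a₂) (ho3 : o ≠ a₃)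
    (hb3 : b ≠ a₃) :
    NMixChord (normDZ2 ends a₁ a₂ a₃) p ends o a₁ a₂ a₃ b f' :=
  nMixChord_DZ2_of_D hp
    (dChord_other_o_edge₂_of_o_root_star_support p ends b hp hf hf' hg he hstar h12 h13 h23 ho1 ho2 ho3 hb3)
    (HCov_o_root_star₂_support (Function.update p f' 0) ends b (hp.update f' le_rfl zero_le_one) hg he
      (fun e' h3 hg' he' => by
        rw [Function.update_of_ne]
        · exact hstar e' h3 hg' he'
        · intro hef
          rw [hef, hf', Sym2.mem_iff] at h3
          rcases h3 with h | h
          · exact ho3 h.symm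
          · exact h13 h.symm)
      h13 h23 ho2 ho3 hb3)

end BSupport

end OStar

end Mix

end Summit.Ventures.PercRepro2
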